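import Mathlib
import HarnessLib
import HarnessLib.Audit
import Summits.HodgeConjecture.Statement
import Summits.HodgeConjecture.HodgeConjecture.Theses.SevenfoldWeilCensus
import Summits.HodgeConjecture.HodgeConjecture.Theorems.WeilTypeLadderNonsplitSixfoldsSqrtMinus3
import Summits.HodgeConjecture.HodgeConjecture.Theorems.WeilTypeLadderNscComponentMinusTwo
import Summits.HodgeConjecture.HodgeConjecture.Theorems.Ring2HypothesesWeilDiscriminantHolds
import Literature.AlgebraicGeometry.HodgeTheory.ComplexGysinCorrespondence
import HarnessLib.Audit.Status.Attr

/-!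
Route: EisensteinThreefoldPieces

CLOSED (retired) 2026-08-28T08:07:15Z by planner-hodge-idea-4-g2-0 — reason: no-dominant-presentation: LEMMA D (discriminant support) + census kit j302972 (max period rank 6/9 on the only 11 [-5]-capable hosts); director R13.19 stop rule — note: exhausted — LINE 1′ (Eisenstein threefold pieces, cell (ℚ(√−3),(3,3),[−5])) is dead for every non-split Eisenstein cell ≠ NSC(−2) over this host space. (1) LEMMA D (DISC-SUPPORT-g2.md, evidence on stmt-HodgeConjecture-25813; director R13.19): the χ-isotypic piece (ℚ(χ)=ℚ(√−3)) of a unimodular G-latt. The file is kept as the record of this route; refuted decls are indexed as negative knowledge (`ledger negatives`).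

# Route EisensteinThreefoldPieces — non-split Eisenstein Weil sixfolds (class [−5]) as Abel–Jacobi
pieces of μ₃/μ₆-threefolds (Schoen one weight up, parity-admissible)

LINE of ideator hodge-idea-4 (D-0145, lens = transfer, KEY director-hodge 2026-08-28T02:30Z) bearing
on rung H2 `SevenfoldWeilCensus.WeilSixfolds`
(stmt-HodgeConjecture-2524), cell (K = ℚ(√−3), d = 3, type (3,3), discriminant class [−5] =
`WeilClassesComponent 3 3 [−5]`, non-split since 5 is inert in ℤ[ω],
9-dimensional; NOT the cell NSC(−2) of UnitaryReflectionCovers). SUPERSEDES this seat's Gaussian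
draft route ThreefoldAbelJacobiPieces, which the odd-n parity wall
(Why this line) kills. REV 2 (R12.16(0) APPLIED, 2026-08-28 g2): X1 and X2 carry the BALANCE clause
`IsWeilType P ψ 3 3` (the Abel–Jacobi piece is of Weil TYPE (3,3),
so its Weil plane consists of Hodge classes — the critic's unbalanced Picard-curve blow-up instance,
type (2,4), is excluded) and X2 is restricted to the prime-order-3
ENGINE SCOPE (one automorphism g with g³ = 1, group-algebra element g − g², whence ψ₀² = −3 and
g-invariants are killed automatically).
It suffices to show X = X1 ∧ X2 ∧ X3: (X1, EisensteinPieceReach) every member of the cell sits on a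
smooth projective family carrying its Weil class flatly, over a
smooth irreducible quasi-projective base, an open set of whose fibres are ℚ(√−3)-isogenous to
ABEL–JACOBI PIECES (P, ψ₀) OF WEIL TYPE (3,3) of smooth projective
threefolds X with an automorphism g of order 3 (μ₃, or the cube-class of a μ₆, in the intended
hosts), h^{3,0}(X) = 0, b₁(X) = 0, the piece being cut out by an
ALGEBRAIC correspondence Γ ∈ CH²(P × X) whose cohomological action T = Γ_* : H³(X) ↠ H¹(P)
intertwines g* − g²* with ψ₀* (so ψ₀² = −3 and T kills the
g-invariants); (X2, EisensteinPieceWeilClasses) on every such Weil-type (3,3) Abel–Jacobi piece the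
ℚ(√−3)-Weil classes are algebraic (Schoen's
group-algebra-cycle theorem Schoen1988HodgeWeil Thm 0.2 — stated for self-products of a variety of
ANY dimension with an automorphism of PRIME order, here 3 —
run on X⁶ instead of C⁶ and transported through SIX copies of Γ: Γ^{×6} ∈ CH¹²(P⁶ × X⁶) followed by
the diagonal pull-back P → P⁶, since the Weil plane
⋀⁶_K H¹(P) ⊂ H⁶(P) is the cup-image of H¹(P)^{⊗6} = T^{⊗6}(H³(X)^{⊗6})); (X3,
OtherSixfoldCellsEisenstein, RESIDUAL = the imported complement, not attacked here)
every other sixfold cell. No summit and no rung is proved by filing this line; it is a thesis with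
three open cruxes.
Lean: `Summit.HodgeConjecture.HodgeConjecture.Theses.EisensteinThreefoldPieces.EisensteinPieceReach
∧ Summit.HodgeConjecture.HodgeConjecture.Theses.EisensteinThreefoldPieces.EisensteinPieceWeilClasses
∧
Summit.HodgeConjecture.HodgeConjecture.Theses.EisensteinThreefoldPieces.OtherSixfoldCellsEisenstein`

## Assembly
Pure logic over the tree's fact-free door `Ring2.Hypotheses.weilSixfolds_iff_components`
(WeilSixfolds ↔ every cell (d, δ)): the cell d = 3, δ = [−5] is proved from
X1 and X2 by the Baire/algebraicity-locus lemma
`WeilTypeLadder.mem_algebraicClasses_of_isOpen_subset_algebraicityLocus`, the isogeny transfer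
`HeckePrymWeilLine.stub_isogenyTransfer` (fed with `IsWeilType.dim_eq` of the piece) and the
transport `HeckePrymWeilLine.owf_isoTransport` (all landed, sorry-free);
every other cell is X3. The deciding theorem `closes` in glue.lean elaborates (lean check rc 0, 0
sorry); all three cruxes are binders of `closes` (BC6), the
Assembly item records the implication it proves.

CLOSES_TARGET: closes rung H2 of HodgeConjecture: Summit.HodgeConjecture.HodgeConjecture.Theses.SevenfoldWeilCensus.WeilSixfolds (D-0061; not the summit Statement) — the deciding theorem of this route concludes that registered leaf instead of the Statement decl `HodgeConjecture` (class rung: servable and labelled, never counted as concluding the summit Statement).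

Rationale: WHY THIS LINE. TRANSFER LENS, first non-transferring step located by instrument: Schoen's method (S1
present the general cell member as a group-algebra piece of
J(C) for a G-curve family DOMINATING the cell; S2 type/discriminant; S3 group-algebra cycles have
non-zero Weil component; S4–S5 spread + Baire) ports
to the non-split sixfold cells only if S1 does, and S1 FAILS FOR EVERY GALOIS-COVER-OF-CURVES
PRESENTATION of every non-split sixfold cell other than
NSC(−2): the class-complete balanced-type enumeration over all eight primitive reflection groups
(pub-hodge-ring2-ab-weil-1 G10Q-III-G30, 1 328 types
of Hurwitz dimension ≥ 9: the only non-split (3,3) types are class [−2] over ℚ(√−3)), the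
level-character theorems (ab-weil-2 LEVEL-G35 §3.8: G₂₉ never
non-split, G₃₁ only in dimension ≤ 8; BORDISM-DISC-G12 THEOREM B), the metacyclic habitat maxima
(HABITAT-G41: 5/7/2 < 9), the monomial no-go (eigen-Pryms
of cyclic covers of the quotient curve: dominant only if étale over genus 4, hence split,
G10Q-PARITY THEOREM L) and this seat's exact check that an
order-3 branch class over ℚ(i) has trivial local discriminant factor (calc/lambda_z3.py) close
weight one. WHY EISENSTEIN AND NOT GAUSSIAN (the parity
wall, this seat 2026-08-28, NOTES ## Barrier notes): on a Weil SIXFOLD with ψ² = −1 the automorphism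
ψ acts on the Weil plane by (±i)⁶ = −1, while every
class produced by Schoen's cyclic-group cycles (or by van Geemen's theta eigen-maps) through an
α-equivariant correspondence is ψ-INVARIANT — so it has zero
Weil component: for K = ℚ(i), n = 3, every cyclic presentation is dead in every weight (this is why
Schoen and van Geemen reach ℚ(i) only in dimension 4).
For μ₃/μ₆ the character obstruction λ⁶ ≠ 1 is absent (λ⁶ = 1), exactly as in Schoen–Faber's ℚ(√−3)
sixfolds C₁₀ → C₄; hence the target cell is Eisenstein. The line therefore moves Schoen's
construction
ONE WEIGHT UP: μ₃/μ₆-threefolds with h^{3,0} = 0 have intermediate Jacobians that are abelian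
varieties, their equivariant moduli are far larger than those of
G-curves, the weight-3 local discriminant law is a different quadratic form (so "symmetric
presentation ⟹ split", THEOREM B, need not recur), and the
Abel–Jacobi isomorphism is induced by an algebraic correspondence when CH₀ is small
(BlochSrinivas1983, Murre1993; Voisin II Ch. 10), which is what lets
Schoen's cycles on X × X be pushed to P × P. Imported areas: intermediate Jacobians / decomposition
of the diagonal (algebraic cycles), Griffiths residue
calculus for G-hypersurfaces (the census instrument), Schoen–van Geemen group-algebra cycles
(vanGeemen1994HodgeAV §7). No listed route of the sub uses
intermediate Jacobians or correspondences from threefolds (CyclicUnitaryPowers: powers of p-cyclic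
curves/surfaces in the SPLIT regime; EisensteinMiddleThird:
ball-quotient Noether–Lefschetz; KuznetsovCYFactory: VHC anchors; UnitaryReflectionCovers (closed):
reflection covers of ℙ¹ in NSC(−2)). REV 2 (critic idea-crit-6 PWP 04:38Z, director R12.16″): the
BALANCE clause is now explicit — the Abel–Jacobi piece (P, ψ₀) is required to be of Weil
TYPE (3,3) (`IsWeilType P ψ 3 3`, van Geemen 4.9: the ω-eigenspace of H^{1,0}(P) has dimension 3),
because the Weil plane ⋀⁶V₊ ⊕ ⋀⁶V₋ of an UNBALANCED piece (type
(2,4): e.g. P = J(C)² for the Picard curve y³ = x⁴ − 1 inside the blow-up of ℙ² × ℙ¹ along C × {0,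
∞}) is non-Hodge and X2 without the clause is false; and X2 is cut
to the prime-order-3 engine (one g with g³ = 1 and group-algebra element g − g²), which is exactly
the scope of Schoen's Thm 0.2 and excludes every parity-walled
datum (λ⁶ ≠ 1) by construction.

RANKED CRUXES. #2 EisensteinPieceReach (crux) — X1 — every sixfold (A, φ), φ² = −3, of discriminant
class [−5] with a rational (3,3) Weil class c is the fibre s₁ of a
smooth projective family f : 𝒳 → S (S smooth irreducible quasi-projective) with a global class W
restricting to c, and over a non-empty open U ⊂ S every fibre is
charted by (A″, φ″) (φ″² = −3, W_t in its Weil plane) ℚ(√−3)-isogenous (u flat, u ≫ v = m, v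
intertwining φ″ with ψ₀) to an Abel–Jacobi piece (P, ψ₀) OF WEIL TYPE
(3,3) (`IsWeilType P ψ₀ 3 3`; the balance of (A″, φ″) follows through the isogeny) of a smooth
projective threefold X with ONE automorphism g, g³ = 1, h^{3,0}(X) = 0,
b₁(X) = 0, cut out by an algebraic Γ ∈ CH²(P × X) with T = Γ_* : H³(X) ↠ H¹(P) and T ∘ (g* − g²*) =
ψ₀* ∘ T. [difficulty: XL] (why it might fail: no μ₃/μ₆-threefold
family with h^{3,0} = 0 may carry a BALANCED ω-piece of H³ of dimension 12 with ≥ 9 equivariant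
moduli submersive onto the 9-dim (3,3) domain AND class [−5];
weighted-hypersurface hosts of weight ≤ 3 show period rank ≤ 7 so far (instrument I1-E, kit
j298762).) [Schoen1988HodgeWeil, vanGeemen1994HodgeAV, BlochSrinivas1983,
arXiv:2502.03415]
#3 EisensteinPieceWeilClasses (crux) — X2 — for every smooth projective threefold X (h^{3,0} = 0, b₁
= 0) with an automorphism g, g³ = 1, every abelian sixfold
(P, ψ₀) OF WEIL TYPE (3,3) over ℚ(√−3) (`IsWeilType P ψ₀ 3 3`) and every algebraic correspondence Γ
∈ CH²(P × X) whose action T : H³(X) → H¹(P) is surjective and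
intertwines g* − g²* with ψ₀*, the ℚ(√−3)-Weil classes of (P, ψ₀) are algebraic: Schoen's
prime-order Thm 0.2 on X⁶ (group-algebra cycles spanning
Res_{K/ℚ} ⋀⁶_K of the ω-piece of H³(X)^{⊗6} ⊂ H¹⁸(X⁶)), transported by SIX copies of Γ — Γ^{×6} ∈
CH¹²(P⁶ × X⁶) takes H¹⁸(X⁶) ⊃ H³(X)^{⊗6} onto H¹(P)^{⊗6} ⊂
H⁶(P⁶), and the diagonal pull-back Δ_P^* : H⁶(P⁶) → H⁶(P) (cup product) lands on ⋀⁶ H¹(P) ⊃ W_K;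
both steps are algebraic correspondences, so algebraicity is
preserved. [difficulty: L] (why it might fail: Schoen's N-data/eigenvalue-multiplicity condition may
fail for the ω-piece of a threefold — it is verified in print
only for (g−1, g−1)-pieces of étale triple covers of curves (Schoen 1988 §7.3, Faber) — and the
engine needs the group-algebra classes to SPAN the 2-dimensional
W_K, not merely meet it.) [Schoen1988HodgeWeil, Schoen1998HodgeWeilAddendum, Koike2004WeilHodge,
Murre1993]
#6 OtherSixfoldCellsEisenstein (crux) — X3 (RESIDUAL, imported complement) — the Weil classes are
algebraic on every sixfold cell other than (ℚ(√−3), [−5]): all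
cells with d ≠ 3, and the Eisenstein cells of class ≠ [−5] (the split cell [−1] is Schoen/Markman in
the tree; NSC(−2) is UnitaryReflectionCovers' cell; the others
are open). [difficulty: open-problem] (why it might fail: it contains every other non-split sixfold
cell (ℚ(i) all odd classes — parity-walled for cyclic
presentations —, ℚ(√−2), ℚ(√−3) [−2], …), none known; declared residual, exactly as hard as H2 minus
one cell; 0 seats, census wording «cell (ℚ(√−3), [−5])
only».) [vanGeemen1994HodgeAV, MoonenZarhin1998WeilClasses, arXiv:2502.03415]

TWO-LAYER PLAN. X1 ⇐ (X1a CENSUS HIT: an explicit G-threefold family — candidates: μ₃/μ₆-equivariant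
weighted hypersurfaces and complete intersections of type
(2,3) ⊂ ℙ⁵, (2,2,2) ⊂ ℙ⁶, cyclic triple solids, double covers of ℙ³ branched in a μ₃-sextic — whose
ω-eigen-piece of H³ is BALANCED with Hodge numbers (3,3),
equivariant Kodaira–Spencer/period rank 9, discriminant class [−5], and host NOT of curve type (J(X)
not isogenous to a product of Jacobians/Pryms of G-curves:
blow-ups of curves and conic bundles re-import weight one and fall to THEOREM B / the parity of 3))
→ (X1b the AJ correspondence Γ for that family is algebraic with
flat isogeny chart over an open set) → X1.
X2 ⇐ (X2a Schoen's Thm 0.2 on X⁶ for the prime-order-3 N-data of the census hit: the group-algebra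
cycle classes span Res ⋀⁶_K of the ω-piece) → (X2b transport
through Γ^{×6} ∈ CH¹²(P⁶ × X⁶) and the diagonal Δ_P : P → P⁶ to H⁶(P)) → X2. Nothing of this is
filed now.

KILL CRITERIA. Refutation of X2 by an explicit (X, g, P, ψ₀, Γ) satisfying the hypotheses with a
non-algebraic Weil class is not available (with the balance clause it
would refute HC); the route is KILLED by: (i) the census instrument I1-E returning NO
μ₃/μ₆-threefold family meeting X1a (h^{3,0} = 0, balanced ω-piece of dimension
12, ≥ 9 submersive equivariant moduli, not of curve type) among diagonal-group weighted
hypersurfaces / complete intersections and cyclic covers of degree ≤ 8 —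
then X1 has no candidate presentation and the line is retired `exhausted` with the census attached;
(ii) a weight-3 analogue of THEOREM B (every symmetric AJ-piece
presentation has split class) — closes the route `refuted:EisensteinPieceReach`; (iii) H2 or the
cell [−5] proved elsewhere (Markman-type secant sheaves for
non-split class) moots it; (iv) a parity-type character obstruction for μ₃ in weight 3 (none: λ⁶ =
1); (v) Schoen's multiplicity condition failing for EVERY
balanced census hit (X2a dead on all hosts) — retire `exhausted`.

NOT DECOMPOSED YET. The census hit (which G-threefold family), the discriminant computation of its
piece (Pham/vanishing-lattice arithmetic), the construction of
Γ (decomposition of the diagonal for the hit: needs CH₀(X) supported on a surface, automatic for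
Fano hits), and the Künneth/cup bookkeeping of X2b (six copies of
Γ) are layer-2 children, filed only after the instrument reports. BC5 witness is PLAN-ONLY:
stub_fanoPieceIsWeilType : for the census hit, the ω-eigen-piece is
an abelian sixfold of Weil type (3,3) — via Griffiths residues; it lies outside S's known regime
because no sixfold of class [−5] has algebraic Weil classes in
print (Schoen/Faber: [−1]; Markman: split).

CHEAPEST FALSIFIER. INSTRUMENT I1-E (ONE batched kit job j298762, μ₃ and μ₆, submitted
2026-08-28T04:12Z; the μ₄ run j298564 was cancelled when the parity wall
killed the Gaussian cell): Griffiths–Jacobian-ring census of diagonal μ₃/μ₆ (× auxiliary μ₂) actions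
on quasi-smooth weighted Fano threefold hypersurfaces of
weights ≤ 3 (incl. cyclic covers), per action: the Hodge numbers of the ω-eigen-piece of H³ (column
«balanced»), the number of equivariant first-order moduli,
the rank of the equivariant infinitesimal period map into Hom(H^{2,1}_ω, H^{1,2}_ω) (9 = dominance)
and the column «host not of curve type». Partial reading
(04:42Z, μ₃ part): 46 balanced ω-pieces of type (3,3)+(3,3) on 8 host families, best equivariant
period rank 7/9 (sextics in ℙ(1,1,1,3,3)); μ₆ part pending at
the time of this revision. If I1-E finds no balanced (3,3) ω-piece with rank 9, kill criterion (i)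
fires for hypersurface hosts of weight ≤ 3 and the line must
move to complete intersections / higher weights in ONE further batched job or be retired with the
census attached (director's stop rule R12.16 (2)).

NUMBERS. dim of the (3,3) cell = dim SU(3,3)/S(U(3)×U(3)) = 9; copies of Γ in the X2 transport = 6
(degree-6 Weil class = cup-image of H¹(P)^{⊗6}); Galois-cover-
of-curves habitats in the non-split ℚ(i) and ℚ(√−3) sixfold cells other than [−2]: ≤ 8 (R¹⁰E₃₄,
LEVEL-G35 §3.8), metacyclic ≤ 5 (HABITAT-G41 T1); reflection-group
balanced types of dimension ≥ 9: over ℚ(i) 48, all split; over ℚ(√−3) the only non-split (3,3) class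
reached is [−2] (G10Q-III-G30 TYPES.tsv). Parity: ψ^* on the
Weil plane of a 2n-fold = (−d)ⁿ; Gaussian λ⁶ = −1 (wall), Eisenstein λ⁶ = 1; for g of order 3, g −
g² acts on the ω/ω²-eigenspaces by ±i√3, (g − g²)² = −3.
μ₄ census (cancelled): 32 balanced rows / 2 664, max period rank 5 < 9; μ₃ partial: 46 balanced, max
rank 7 < 9. Threefold side: h^{2,1} of candidate hosts:
cubic 5, (2,2,2) 14, quartic double solid 10, (2,3) 20, quartic 30, sextic double solid 52
(standard).

DEFINITION REQUESTS. None: the Abel–Jacobi piece is expressed through the tree's `corrAction μ`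
(ComplexGysinCorrespondence), `algebraicClasses (P.X ⊗ X) 2` and
`HodgeTheory.IsWeilType`; an honest `IntermediateJacobian` structure (analogue of
`Motives.Jacobian`) would shorten X1/X2 and may be requested by the first prover.

Novelty: Searches (2026-08-28): lit search --hybrid "intermediate Jacobian of a threefold with automorphism
is an abelian variety of Weil type; Hodge conjecture for Weil classes via Abel-Jacobi map" (8 docs:
carlson2017 pp120–123, green1994 pp196/214/234, voisin2003 — general AJ/normal-function material, no
Weil-type statement); lit search "Weil intermediate Jacobian cubic threefold automorphism" (6 local,
Clemens–Griffiths/cubic-threefold IJ literature, none on Weil type); lit galaxy search "Weil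
type|intermediate Jacobian|exceptional Hodge classes" --star pdf (10 hits, nearest
pdf:-5037018919609425800 Laga–Shnidman Ceresa vanishing under H³(J)^{Aut C}=0 — curves, not
threefolds); tree: rg over Theses/ of the sub (no route mentions intermediate Jacobians or
corrAction); ledger negatives --problem HodgeConjecture (6 entries, none related).
Nearest prior art found: Schoen1988HodgeWeil (group-algebra cycles on Cⁿ for a G-curve, Thm 0.2
general, applied in weight 1 only), Koike2004WeilHodge (Schoen's method for further weight-1 data),
vanGeemen1994HodgeAV §7 (survey of both methods), arXiv:2502.03415 (Markman: split sixfolds via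
secant sheaves on generalised Kummers); half-twist constructions of Weil-type AVs from K3/CY
weight-2/3 Hodge structures (van Geemen, "Half twists of Hodge structures of CM-type", J. Math. Soc.
Japan 53 (2001)) give the Hodge structure but no cycles.
Delta: run Schoen's prime-order group-algebra-cycle theorem on a μ₃-THREEFOLD and push it through an
algebraic Abe  [refs: 2502.03415]

Barriers (technique_class: explicit-family, abel-jacobi, group-cycles, variational): - technique_class: explicit-family, abel-jacobi, group-cycles, variational
- ODD-n PARITY WALL (this seat, NOTES ## Barrier notes; not yet catalogued under
Literature/Barriers): ψ^* = (−d)ⁿ-sign on the Weil plane; for Gaussian sixfolds every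
cyclic-automorphism-equivariant cycle has zero Weil component. EVADED by the choice of cell: K =
ℚ(√−3), hosts with μ₃/μ₆, character λ with λ⁶ = 1 (Schoen–Faber's sixfold regime); X2's general θ
still contains walled instances (its why-might-fail), the intended instances are prime order 3.
- Literature.Barriers.HodgeConjecture.Voisin2003_generalHypersurface_noIntegralClassInF: outside —
Griffiths' programme (Lefschetz pencil + Jacobi inversion + normal functions on a GENERAL
hypersurface slice) is not used; the Abel–Jacobi map enters only for SPECIAL G-threefolds with
h^{3,0} = 0, where J(X) is an abelian variety and AJ is induced by an algebraic correspondence Γ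
(decomposition of the diagonal), and algebraicity comes from explicit group-algebra cycles on X × X,
not from inverting AJ on a general member.
- Literature.Barriers.HodgeConjecture.Voisin2003_generalHypersurface_noIntegralClassInF_Narrow:
outside for the same reason — no slice of Hodge level ≥ 2 is asked to have surjective Abel–Jacobi
map; X1 demands h^{3,0}(X) = 0 (level-one H³) precisely so that AJ is algebraic.
- Literature.Barriers.HodgeConjecture.BlochSrinivas1983_hodgeTypeL0_vanish_of_chowZeroSupported:
used as a RESOURCE — CH₀(X) supported on a surface ⟹ h^{3,0} = 0 and t

History (route lifecycle, newest last):
- 2026-08-28T04:36:20Z · rev 1: restated OtherSixfoldCellsEisenstein (stmt-HodgeConjecture-25677) — restate residual X3 with the cell statements INLINED (was phrased through the @[conjecture] def Ring2.Hypotheses.WeilClassesComponent, which the gate flags unde (planner-hodge-idea-4-g0-0)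
- 2026-08-28T05:12:41Z · rev 2: restated EisensteinPieceReach (stmt-HodgeConjecture-25675), EisensteinPieceWeilClasses (stmt-HodgeConjecture-25676) — rev 2: R12.16(0) APPLIED — balance clause `IsWeilType P ψ 3 3` added to X2's binders and inside X1's ∃ (critic idea-crit-6 PWP 04:38Z counter-instance, Picard-c (planner-hodge-idea-4-g2-0)
- 2026-08-28T08:07:15Z · CLOSED retired — no-dominant-presentation: LEMMA D (discriminant support) + census kit j302972 (max period rank 6/9 on the only 11 [-5]-capable hosts); director R13.19 stop rule (planner-hodge-idea-4-g2-0)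

sub-problem: HodgeConjecture · status: closed(retired) · opened planner-hodge-idea-4-g0-0 2026-08-28T04:28:17Z · rev 2 · ledger route-HodgeConjecture-EisensteinThreefoldPieces
GENERATED by the gate from the ledger (D-0016/17). Provers cite these decls: `theorem foo : Summit.HodgeConjecture.HodgeConjecture.Theses.EisensteinThreefoldPieces.<Decl> := …` in Summits/HodgeConjecture/HodgeConjecture/Theorems/<Name>.lean.
-/

namespace Summit.HodgeConjecture.HodgeConjecture.Theses.EisensteinThreefoldPieces

open scoped BigOperators Topology Manifold Classical MeasureTheory ProbabilityTheory Matrix InnerProductSpace ComplexConjugate ContinuousMap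
open Filter Set Function TopologicalSpace MeasureTheory

attribute [summit_statement] _root_.HodgeConjecture
attribute [summit_statement] _root_.Summit.HodgeConjecture.HodgeConjecture.Theses.SevenfoldWeilCensus.WeilSixfolds

-- earlier EisensteinPieceReach (stmt-HodgeConjecture-25675, replaced 2026-08-28T05:12:41Z -> stmt-HodgeConjecture-25813): retired by None — open CategoryTheory Literature.AlgebraicGeometry.Motives Literature.AlgebraicGeometry.HodgeTheory Literature.AlgebraicGeometry.VanGeemen1994 in ∀ (A : AbelianVariety ℂ) (φ : A ⟶ A), A.dim = 2 * 3 → IsSmoothProjective (2 * 3) A.X → φ ≫ φ = -((3 : ℕ) • 𝟙 A) → ∀ (e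
/-- item stmt-HodgeConjecture-25813 · crux · rank 2 · closed · moot by None · by planner
why it might fail: no μ₃/μ₆-threefold family with h^{3,0}=0 may carry a BALANCED ω-piece of H³ of dim 12 with ≥ 9 equivariant moduli submersive onto the 9-dim (3,3) domain AND class [−5]; weight-≤3 hypersurface hosts show period rank ≤ 7 so far (instrument I1-E, kit j298762).
sources: Schoen1988HodgeWeil, vanGeemen1994HodgeAV, BlochSrinivas1983, arXiv:2502.03415
[crux] X1 (rev 2, R12.16(0) applied: BALANCE clause + prime-order-3 engine scope) — every sixfold
(A, φ), φ² = −3, of discriminant class [−5] with a rational (3,3) Weil class c is the fibre s₁ of a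
smooth projective family f : 𝒳 → S (S smooth irreducible quasi-projective) with a global class W
restricting to c, and over a non-empty open U ⊂ S every fibre is charted by (A″, φ″), φ″² = −3, W_t
in its Weil plane, ℚ(√−3)-isogenous (u flat, u ≫ v = m, v intertwining φ″ with ψ₀) to an Abel–Jacobi
piece (P, ψ₀) OF WEIL TYPE (3,3) (`IsWeilType P ψ₀ 3 3`: the ω-eigenspace of H^{1,0}(P) has
dimension 3; the balance of (A″, φ″) follows through the isogeny) of a smooth projective threefold X
with ONE automorphism g, g³ = 1 (μ₃, or the cube-class of μ₆, in the intended hosts), h^{3,0}(X) =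
0, b₁(X) = 0, cut out by an ALGEBRAIC Γ ∈ CH²(P × X) whose action T = Γ_* : H³(X) ↠ H¹(P) satisfies
T ∘ (g* − g²*) = ψ₀* ∘ T (so ψ₀² = −3 and T kills the g-invariants of H³). [deps: none] [difficulty:
XL] -/
@[route_item "route-HodgeConjecture-EisensteinThreefoldPieces", crux]
def EisensteinPieceReach : Prop :=
  open CategoryTheory Literature.AlgebraicGeometry.Motives Literature.AlgebraicGeometry.HodgeTheory Literature.AlgebraicGeometry.VanGeemen1994 in ∀ (A : AbelianVariety ℂ) (φ : A ⟶ A), A.dim = 2 * 3 → IsSmoothProjective (2 * 3) A.X → φ ≫ φ = -((3 : ℕ) • 𝟙 A) → ∀ (e : ProjectiveEmbedding A.X) (a : complexBetti (projectiveSpace e.n ℂ) 2), IsRationalClass a → a ≠ 0 → HasWeilDiscriminantNondeg A φ 3 3 (((3 : ℕ) : ℂ) • complexBetti.map e.ι 2 a + complexBetti.map φ.hom.hom.hom 2 (complexBetti.map e.ι 2 a)) (QuotientGroup.mk (Units.mk0 (-5 : ℚ) (by norm_num))) → ∀ c : complexBetti A.X (2 * 3), IsRationalClass c → IsOfHodgeType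 (2 * 3) A.X (2 * 3) 3 3 c → c ∈ weilClassesOf A φ 3 3 → ∃ (𝒳 S : SchemeOver ℂ) (f : 𝒳 ⟶ S) (s₁ : ComplexPoints S) (ι : A.X ≅ fiberOver f s₁) (W : complexBetti 𝒳 (2 * 3)) (U : Set (ComplexPoints S)), IsSmoothProjectiveFamily f (2 * 3) ∧ IsQuasiProjectiveOver 𝒳 ∧ IsQuasiProjectiveOver S ∧ IrreducibleSpace S.left ∧ AlgebraicGeometry.Smooth S.hom ∧ complexBetti.map ι.hom (2 * 3) (complexBetti.map (fiberι f s₁) (2 * 3) W) = c ∧ IsOpen U ∧ U.Nonempty ∧ ∀ t ∈ U, ∃ (B : AbelianVariety ℂ) (χ : B ⟶ B) (eB : B.X ≅ fiberOver f t), B.dim = 2 * 3 ∧ χ ≫ χ = -((3 : ℕ) • 𝟙 B) ∧ complexBetti.map eB.hom (2 * 3) (complexBetti.map (fiberι f t) (2 * 3) W) ∈ weilClassesOf B χ 3 3 ∧ ∃ (X : SchemeOver ℂ) (hX : IsSmoothProjective 3 X) (g : X ⟶ X) (P : AbelianVariety ℂ) (hP : IsSmoothProjective (2 * 3) P.X)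 (ψ : P ⟶ P) (μ : OrientationFamily) (Γ : complexBetti (MonoidalCategoryStruct.tensorObj P.X X) (2 * 2)) (u : B ⟶ P) (v : P ⟶ B) (m : ℕ), let T : complexBetti X 3 →ₗ[ℂ] complexBetti P.X 1 := corrAction μ hP hX (by norm_num) Γ; g ≫ g ≫ g = 𝟙 X ∧ (∀ x : complexBetti X 3, IsOfHodgeType 3 X 3 3 0 x → x = 0) ∧ Module.finrank ℂ (complexBetti X 1) = 0 ∧ IsWeilType P ψ 3 3 ∧ μ.HasPoincareDuality ∧ Γ ∈ algebraicClasses (MonoidalCategoryStruct.tensorObj P.X X) 2 ∧ Function.Surjective T ∧ T ∘ₗ ((complexBetti.map g 3).hom - (complexBetti.map (g ≫ g) 3).hom) = (complexBetti.map ψ.hom.hom.hom 1).hom ∘ₗ T ∧ 0 < m ∧ u ≫ v = m • 𝟙 B ∧ AlgebraicGeometry.Flat u.hom.hom.hom.left ∧ v ≫ χ = ψ ≫ v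

-- earlier EisensteinPieceWeilClasses (stmt-HodgeConjecture-25676, replaced 2026-08-28T05:12:41Z -> stmt-HodgeConjecture-25814): retired by None — open CategoryTheory Literature.AlgebraicGeometry.Motives Literature.AlgebraicGeometry.HodgeTheory Literature.AlgebraicGeometry.VanGeemen1994 in ∀ (X : SchemeOver ℂ) (hX : IsSmoothProjective 3 X) (k : ℕ) (α : Fin k → (X ⟶ X)) (θ : Fin k → ℤ) (P : AbelianVar
/-- item stmt-HodgeConjecture-25814 · crux · rank 3 · closed · moot by None · by planner
why it might fail: Schoen's eigenvalue-multiplicity (N-data) condition may fail for the ω-piece of a threefold — in print it is checked only for (g−1,g−1)-pieces of étale triple covers of curves (Schoen §7.3/Faber) — and the group-algebra classes must SPAN the 2-dim W_K after transport through Γ^{×6}.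
sources: Schoen1988HodgeWeil, Schoen1998HodgeWeilAddendum, Koike2004WeilHodge, Murre1993
[crux] X2 (rev 2, R12.16(0) applied) — for every smooth projective threefold X (h^{3,0} = 0, b₁ = 0)
with an automorphism g, g³ = 1, every abelian sixfold (P, ψ₀) OF WEIL TYPE (3,3) over ℚ(√−3)
(`IsWeilType P ψ₀ 3 3` — without this clause the Weil plane of an unbalanced piece, e.g. type (2,4)
from the Picard-curve blow-up, is non-Hodge and the statement is false) and every algebraic
correspondence Γ ∈ CH²(P × X) whose action T : H³(X) → H¹(P) is surjective with T ∘ (g* − g²*) = ψ₀*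
∘ T, the ℚ(√−3)-Weil classes of (P, ψ₀) are algebraic. ENGINE = Schoen's prime-order Thm 0.2 on X⁶
(group-algebra cycles spanning Res_{K/ℚ} ⋀⁶_K of the ω-piece of H³(X)^{⊗6} ⊂ H¹⁸(X⁶)) transported by
SIX copies of Γ: Γ^{×6} ∈ CH¹²(P⁶ × X⁶) maps H³(X)^{⊗6} onto H¹(P)^{⊗6} ⊂ H⁶(P⁶), then the diagonal
pull-back Δ_P^* : H⁶(P⁶) → H⁶(P) = ⋀⁶H¹(P) ⊃ W_K (cup product); both steps are algebraic
correspondences. Scope is exactly prime order 3 (λ⁶ = 1: no parity wall). [deps: none] [difficulty: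
L] -/
@[route_item "route-HodgeConjecture-EisensteinThreefoldPieces", crux]
def EisensteinPieceWeilClasses : Prop :=
  open CategoryTheory Literature.AlgebraicGeometry.Motives Literature.AlgebraicGeometry.HodgeTheory Literature.AlgebraicGeometry.VanGeemen1994 in ∀ (X : SchemeOver ℂ) (hX : IsSmoothProjective 3 X) (g : X ⟶ X) (P : AbelianVariety ℂ) (hP : IsSmoothProjective (2 * 3) P.X) (ψ : P ⟶ P) (μ : OrientationFamily) (Γ : complexBetti (MonoidalCategoryStruct.tensorObj P.X X) (2 * 2)), let T : complexBetti X 3 →ₗ[ℂ] complexBetti P.X 1 := corrAction μ hP hX (by norm_num) Γ; g ≫ g ≫ g = 𝟙 X → (∀ x : complexBetti X 3, IsOfHodgeType 3 X 3 3 0 x → x = 0) → Module.finrank ℂ (complexBetti X 1) = 0 → IsWeilType P ψ 3 3 → μ.HasPoincareDuality → Γ ∈ algebraicClasses (MonoidalCategoryStruct.tensorObj P.X X) 2 → Function.Surjective T → T ∘ₗ ((complexBetti.map g 3).hom - (complexBetti.map (g ≫ g) 3).hom) = (complexBetti.map ψ.hom.hom.hom 1).hom ∘ₗ T → weilClassesOf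 P ψ 3 3 ≤ algebraicClasses P.X 3

-- earlier OtherSixfoldCellsEisenstein (stmt-HodgeConjecture-25677, replaced 2026-08-28T04:36:20Z -> stmt-HodgeConjecture-25711): retired by None — open CategoryTheory Literature.AlgebraicGeometry.Motives Literature.AlgebraicGeometry.HodgeTheory Literature.AlgebraicGeometry.VanGeemen1994 in (∀ d : ℕ, 0 < d → d ≠ 3 → ∀ δ : weilNormResidueGroup d, Summit.HodgeConjecture.HodgeConjecture.Ring2.Hypotheses
/-- item stmt-HodgeConjecture-25711 · crux · rank 6 · closed · moot by None · by planner
why it might fail: it contains every other non-split sixfold cell (ℚ(i) all odd classes — parity-walled for cyclic presentations —, ℚ(√−2), ℚ(√−3) [−2], …), none known; declared residual, exactly as hard as H2 minus one cell.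
sources: vanGeemen1994HodgeAV, MoonenZarhin1998WeilClasses, arXiv:2502.03415
[crux] X3 (RESIDUAL, imported complement) — the Weil classes are algebraic on every sixfold cell
other than (ℚ(√−3), [−5]): all cells with d ≠ 3, and the Eisenstein cells of class ≠ [−5] (the split
cell [−1] is Schoen/Markman in the tree; NSC(−2) is UnitaryReflectionCovers' cell; the others are
open). [difficulty: open-problem] -/
@[route_item "route-HodgeConjecture-EisensteinThreefoldPieces", crux]
def OtherSixfoldCellsEisenstein : Prop :=
  open CategoryTheory Literature.AlgebraicGeometry.Motives Literature.AlgebraicGeometry.HodgeTheory Literature.AlgebraicGeometry.VanGeemen1994 in (∀ d : ℕ, 0 < d → d ≠ 3 → ∀ δ : weilNormResidueGroup d, ∀ (A : AbelianVariety ℂ) (φ : A ⟶ A), A.dim = 2 * 3 → IsSmoothProjective (2 * 3) A.X → φ ≫ φ = -(d • 𝟙 A) → ∀ (e : ProjectiveEmbedding A.X) (a : complexBetti (projectiveSpace e.n ℂ) 2), IsRationalClass a → a ≠ 0 → HasWeilDiscriminantNondeg A φ 3 d ((d : ℂ) • complexBetti.map e.ι 2 a + complexBetti.map φ.hom.hom.hom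 2 (complexBetti.map e.ι 2 a)) δ → ∀ c : complexBetti A.X (2 * 3), IsRationalClass c → IsOfHodgeType (2 * 3) A.X (2 * 3) 3 3 c → c ∈ weilClassesOf A φ 3 d → c ∈ algebraicClasses A.X 3) ∧ (∀ δ : weilNormResidueGroup 3, δ ≠ QuotientGroup.mk (Units.mk0 (-5 : ℚ) (by norm_num)) → ∀ (A : AbelianVariety ℂ) (φ : A ⟶ A), A.dim = 2 * 3 → IsSmoothProjective (2 * 3) A.X → φ ≫ φ = -(3 • 𝟙 A) → ∀ (e : ProjectiveEmbedding A.X) (a : complexBetti (projectiveSpace e.n ℂ) 2), IsRationalClass a → a ≠ 0 → HasWeilDiscriminantNondeg A φ 3 3 ((3 : ℂ) • complexBetti.map e.ι 2 a + complexBetti.map φ.hom.hom.hom 2 (complexBetti.map e.ι 2 a)) δ → ∀ c : complexBetti A.X (2 * 3), IsRationalClass c → IsOfHodgeType (2 * 3) A.X (2 * 3) 3 3 c → c ∈ weilClassesOf A φ 3 3 → c ∈ algebraicClasses A.X 3)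

/-- item stmt-HodgeConjecture-25678 · assembly · rank 1 · closed · moot by None · by planner
sources: Schoen1988HodgeWeil, vanGeemen1994HodgeAV
[assembly] X1 → X2 → X3 → WeilSixfolds (the deciding theorem `closes` proves exactly this
implication; kept as the schema's assembly item). -/
@[route_item "route-HodgeConjecture-EisensteinThreefoldPieces"]
def Assembly : Prop :=
  Summit.HodgeConjecture.HodgeConjecture.Theses.EisensteinThreefoldPieces.EisensteinPieceReach → Summit.HodgeConjecture.HodgeConjecture.Theses.EisensteinThreefoldPieces.EisensteinPieceWeilClasses → Summit.HodgeConjecture.HodgeConjecture.Theses.EisensteinThreefoldPieces.OtherSixfoldCellsEisenstein → Summit.HodgeConjecture.HodgeConjecture.Theses.SevenfoldWeilCensus.WeilSixfolds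

/-! D-0027 §2.1 — DECIDING THEOREM (planner-authored via `route open/edit --closes-file`; by planner-hodge-idea-4-g2-0 2026-08-28T05:12:41Z) — ARCHIVED: route closed (retired) 2026-08-28T08:07:15Z; kept so importers keep building:
its hypotheses are this route's items and its conclusion the registered leaf `Summit.HodgeConjecture.HodgeConjecture.Theses.SevenfoldWeilCensus.WeilSixfolds` (rung H2, D-0061) (glue_lint), and it elaborates with this file. -/

@[closes "route-HodgeConjecture-EisensteinThreefoldPieces"] theorem closes (h1 : EisensteinPieceReach) (h2 : EisensteinPieceWeilClasses) (h3 : OtherSixfoldCellsEisenstein) :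
    Summit.HodgeConjecture.HodgeConjecture.Theses.SevenfoldWeilCensus.WeilSixfolds := by
  -- the route's own cell: (ℚ(√-3), sixfolds, discriminant class [-5]) from X1 (Abel–Jacobi piece reach) and X2 (piece algebraicity)
  have key : Summit.HodgeConjecture.HodgeConjecture.Ring2.Hypotheses.WeilClassesComponent 3 3
      (QuotientGroup.mk (Units.mk0 (-5 : ℚ) (by norm_num))) := by
    intro A φ hA hX hφ e a ha ha0 hdisc c hcQ hcH hcW
    obtain ⟨𝒳, S, f, s₁, ι, W, U, hf, h𝒳, hSqp, hirr, hsm, hιc, hU, hUne, hPiece⟩ :=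
      h1 A φ hA hX hφ e a ha ha0 hdisc c hcQ hcH hcW
    rw [← hιc]
    haveI := hirr
    refine Summit.HodgeConjecture.HodgeConjecture.Theorems.isoInvariance_proof ι 3 _
      (Summit.HodgeConjecture.HodgeConjecture.WeilTypeLadder.mem_algebraicClasses_of_isOpen_subset_algebraicityLocus
        f h𝒳 hSqp hsm hf W hU hUne ?_ s₁)
    intro t ht
    obtain ⟨B, χ, eB, hBdim, hχ, hWeil, X, hX3, g, P, hP, ψ, μ, Γ, u, v, m, hg, hlev, hq,
      hWT, hμ, hΓ, hsurj, hinter, hm, huv, hu, hv⟩ := hPiece t ht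
    have hPalg : Literature.AlgebraicGeometry.HodgeTheory.weilClassesOf P ψ 3 3 ≤
        Literature.AlgebraicGeometry.HodgeTheory.algebraicClasses P.X 3 :=
      h2 X hX3 g P hP ψ μ Γ hg hlev hq hWT hμ hΓ hsurj hinter
    have hPdim : P.dim = 2 * 3 := hWT.dim_eq
    have hχℤ : CategoryTheory.CategoryStruct.comp χ χ = -(((3 : ℕ) : ℤ) • CategoryTheory.CategoryStruct.id B) := by
      rw [hχ, natCast_zsmul]
    have hBalg : Literature.AlgebraicGeometry.HodgeTheory.weilClassesOf B χ 3 3 ≤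
        Literature.AlgebraicGeometry.HodgeTheory.algebraicClasses B.X 3 :=
      Summit.HodgeConjecture.HodgeConjecture.Theorems.HeckePrymWeilLine.stub_isogenyTransfer 3 3 B _ χ ψ hBdim
        hPdim hχℤ u v m hm huv hu hv hPalg
    exact Summit.HodgeConjecture.HodgeConjecture.Theorems.HeckePrymWeilLine.owf_isoTransport _ B eB 3 _ (hBalg hWeil)
  refine Summit.HodgeConjecture.HodgeConjecture.Ring2.Hypotheses.weilSixfolds_iff_components.2 fun d hd δ => ?_
  by_cases hd1 : d = 3
  · subst hd1
    by_cases hδ : δ = QuotientGroup.mk (Units.mk0 (-5 : ℚ) (by norm_num))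
    · subst hδ
      exact key
    · exact h3.2 δ hδ
  · exact h3.1 d hd hd1 δ

end Summit.HodgeConjecture.HodgeConjecture.Theses.EisensteinThreefoldPieces
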